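import Summits.Ventures.HodgeRepro2.T5InertSelfDualUnique
import Summits.Ventures.HodgeRepro2.T5HermitianIsotropicLattice
import Summits.Ventures.HodgeRepro2.T5HeckeIsomorphismTransport

/-!
# The spherical Hecke algebra at an inert place does not depend on the self-dual lattice
(cell pub-hodge-repro2, seat p3)

Tier-5 N3 support. By file 182 any two self-dual lattices `Q₁ 𝒪³`, `Q₂ 𝒪³` of `(L_w³, H)` at an inert place have
integrally congruent Gram matrices (`Q₂ᴴ H Q₂ = Mᴴ (Q₁ᴴ H Q₁) M`, `M ∈ GL₃(𝒪_{E_v})`). Seat p8's T5-137b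
`map_conj_hyperspecialSubgroup` carries the hyperspecial subgroup `K_{G₂} ≤ U(G₂)` onto `K_{G₁} ≤ U(G₁)` along the
conjugation `U(Mᴴ G₁ M) ≃* U(G₁)`, and p8's T5-142 `heckeAlgebraEquivOfMulEquiv` turns that into an isomorphism
of the spherical Hecke algebras. Hence the record's `H(U(V_v), K_v)` is, up to isomorphism, independent of the
choice of the self-dual lattice `L_v`:
* `exists_congruent_integral_of_J3_one` — two Gram matrices both integrally congruent to `antidiag(1, 1, 1)` are
  integrally congruent to each other (abstract `R`, `E`);
* `nonempty_heckeAlgebra_algEquiv_of_congruent_integral` — integrally congruent unimodular Gram matrices have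
  isomorphic spherical Hecke algebras (abstract);
* **`nonempty_heckeAlgebra_algEquiv_of_dualLattice_eq`** — on `L_w` at an inert place, for any two self-dual
  lattices of `(L_w³, H)`.

Mathlib + this seat's file 182 + seat p8's T5-137b / T5-142 and their imports; no display; no device. §8(d): uses
an L-value-free non-vanishing device: NO.
-/

namespace Summit.Ventures.HodgeRepro2.T5InertSelfDualHecke

open Matrix IsDedekindDomain IsDedekindDomain.HeightOneSpectrum NumberField Module
open Summit.Ventures.HodgeRepro2.T5IntegralUnits Summit.Ventures.HodgeRepro2.T5HermitianThreeElements
  Summit.Ventures.HodgeRepro2.T5UnitaryGroupIsometry Summit.Ventures.HodgeRepro2.T5StarOfInvolution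
  Summit.Ventures.HodgeRepro2.T5InertHeckeCommutative Summit.Ventures.HodgeRepro2.T5UnitaryThreeCorner
  Summit.Ventures.HodgeRepro2.T5InertSelfDualNormalForm Summit.Ventures.HodgeRepro2.T5InertSelfDualUnique
  Summit.Ventures.HodgeRepro2.T5HermitianIsotropicForm Summit.Ventures.HodgeRepro2.T5HermitianIsotropicLattice
  Summit.Ventures.HodgeRepro2.T5UnitaryHeckeAdjoint Summit.Ventures.HodgeRepro2.T5HeckePermutationModule
  Summit.Ventures.HodgeRepro2.T5HeckeIsomorphismTransport

/-! ## Abstract: integral congruence and the transport of the hyperspecial subgroup -/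

section General

variable {R E : Type*} [CommRing R] [Field E] [Algebra R E] [StarRing E]

/-- Two Gram matrices that are both integrally congruent to `antidiag(1, 1, 1)` are integrally congruent to each
other: `G₂ = Mᴴ G₁ M` with `M := P₁ P₂⁻¹ ∈ GL₃(R)`. -/
theorem exists_congruent_integral_of_J3_one {G₁ G₂ P₁ P₂ : Matrix (Fin 3) (Fin 3) E}
    (hP₁ : ∀ i j, IsLocalization.IsInteger R (P₁ i j)) (hP₁det : IsRUnit R P₁.det)
    (h₁ : P₁.conjTranspose * G₁ * P₁ = J3 1)
    (hP₂ : ∀ i j, IsLocalization.IsInteger R (P₂ i j)) (hP₂det : IsRUnit R P₂.det)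
    (h₂ : P₂.conjTranspose * G₂ * P₂ = J3 1) :
    ∃ M : Matrix (Fin 3) (Fin 3) E, (∀ i j, IsLocalization.IsInteger R (M i j)) ∧ IsRUnit R M.det ∧
      G₂ = M.conjTranspose * G₁ * M := by
  have hP₂det' : IsUnit P₂.det := isUnit_iff_exists_inv.2 ⟨P₂.det⁻¹, mul_inv_cancel₀ hP₂det.2.1⟩
  refine ⟨P₁ * P₂⁻¹, isInteger_mul_apply hP₁ (isInteger_inv_apply_of_isRUnit_det hP₂ hP₂det), ?_, ?_⟩
  · rw [Matrix.det_mul, Matrix.det_nonsing_inv, Ring.inverse_eq_inv]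
    exact isRUnit_mul hP₁det (isRUnit_inv hP₂det)
  · calc G₂ = (P₂ * P₂⁻¹).conjTranspose * G₂ * (P₂ * P₂⁻¹) := by
          rw [Matrix.mul_nonsing_inv _ hP₂det', Matrix.conjTranspose_one, Matrix.one_mul, Matrix.mul_one]
      _ = (P₂⁻¹).conjTranspose * (P₂.conjTranspose * G₂ * P₂) * P₂⁻¹ := by
          simp only [Matrix.conjTranspose_mul, Matrix.mul_assoc]
      _ = (P₂⁻¹).conjTranspose * (P₁.conjTranspose * G₁ * P₁) * P₂⁻¹ := by rw [h₂, h₁]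
      _ = (P₁ * P₂⁻¹).conjTranspose * G₁ * (P₁ * P₂⁻¹) := by
          simp only [Matrix.conjTranspose_mul, Matrix.mul_assoc]

/-- **Integrally congruent Gram matrices have isomorphic spherical Hecke algebras**: if `G₂ = Mᴴ G₁ M` with
`M ∈ GL₃(R)`, the conjugation `U(G₂) ≃* U(G₁)` by `M` (p8's `formUnitaryGroupMulEquiv_conj`) carries the
hyperspecial subgroup `K_{G₂}` onto `K_{G₁}` (p8's `map_conj_hyperspecialSubgroup`), so p8's
`heckeAlgebraEquivOfMulEquiv` gives `H(U(G₂), K_{G₂}) ≃ₐ[k] H(U(G₁), K_{G₁})`. -/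
theorem nonempty_heckeAlgebra_algEquiv_of_congruent_integral (k : Type*) [Field k] [IsFractionRing R E]
    {G₁ G₂ M : Matrix (Fin 3) (Fin 3) E}
    (hM : ∀ i j, IsLocalization.IsInteger R (M i j)) (hMdet : IsRUnit R M.det)
    (hG : G₂ = M.conjTranspose * G₁ * M) :
    Nonempty (heckeAlgebra k (hyperspecialSubgroup R G₂) ≃ₐ[k] heckeAlgebra k (hyperspecialSubgroup R G₁)) := by
  subst hG
  have hMdet' : IsUnit M.det := isUnit_iff_exists_inv.2 ⟨M.det⁻¹, mul_inv_cancel₀ hMdet.2.1⟩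
  have hmem : Matrix.GeneralLinearGroup.mk'' M hMdet' ∈ (Matrix.GeneralLinearGroup.map (algebraMap R E)).range :=
    mem_range_of_isInteger_of_isRUnit_det hM hMdet
  have key := map_conj_hyperspecialSubgroup G₁ _ hmem
  refine ⟨heckeAlgebraEquivOfMulEquiv k (formUnitaryGroupMulEquiv_conj G₁ (Matrix.GeneralLinearGroup.mk'' M hMdet'))
    fun g => ?_⟩
  rw [← key, Subgroup.mem_map_equiv, MulEquiv.symm_apply_apply]
  exact Iff.rfl

end General

/-! ## On the record's local fields: any two self-dual lattices give isomorphic Hecke algebras -/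

section Local

variable {K : Type*} [Field K] [NumberField K] (v : HeightOneSpectrum (𝓞 K))
variable {L : Type*} [Field L] [NumberField L] [Algebra K L]
variable (w : HeightOneSpectrum (𝓞 L)) [w.asIdeal.LiesOver v.asIdeal]

/-- **The spherical Hecke algebra of `U(H)` at an inert place is independent of the self-dual lattice**: under the
hypotheses of file 182, for two self-dual lattices `Q₁ 𝒪³`, `Q₂ 𝒪³` of `(L_w³, H)` the Hecke algebras
`H(U(Q₂ᴴ H Q₂), K)` and `H(U(Q₁ᴴ H Q₁), K)` (p8's `heckeAlgebra` over the hyperspecial subgroups of the standard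
lattice, T5-128 / T5-5x) are isomorphic `k`-algebras. -/
theorem nonempty_heckeAlgebra_algEquiv_of_dualLattice_eq (k : Type*) [Field k]
    (h2 : finrank (v.adicCompletion K) (w.adicCompletion L) = 2)
    {ϖ : v.adicCompletionIntegers K} (hϖ : Irreducible ϖ)
    (hinert : Irreducible (algebraMap (v.adicCompletionIntegers K) (w.adicCompletionIntegers L) ϖ))
    (σ : w.adicCompletion L ≃ₐ[v.adicCompletion K] w.adicCompletion L) (hσ : σ ≠ 1)
    {H : Matrix (Fin 3) (Fin 3) (w.adicCompletion L)}
    (hH : letI := starRingOfQuadratic h2 σ hσ; H.IsHermitian) (hdet : IsUnit H.det)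
    {Q₁ Q₂ : Matrix (Fin 3) (Fin 3) (w.adicCompletion L)} (hQ₁ : IsUnit Q₁) (hQ₂ : IsUnit Q₂)
    (h₁ : letI := starRingOfQuadratic h2 σ hσ
      dualLattice (integralClosure (v.adicCompletionIntegers K) (w.adicCompletion L))
        (Q₁.conjTranspose * H * Q₁)
        (stdLattice (integralClosure (v.adicCompletionIntegers K) (w.adicCompletion L))) =
      stdLattice (integralClosure (v.adicCompletionIntegers K) (w.adicCompletion L)))
    (h₂ : letI := starRingOfQuadratic h2 σ hσ
      dualLattice (integralClosure (v.adicCompletionIntegers K) (w.adicCompletion L))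
        (Q₂.conjTranspose * H * Q₂)
        (stdLattice (integralClosure (v.adicCompletionIntegers K) (w.adicCompletion L))) =
      stdLattice (integralClosure (v.adicCompletionIntegers K) (w.adicCompletion L))) :
    letI := starRingOfQuadratic h2 σ hσ
    Nonempty
      (heckeAlgebra k (hyperspecialSubgroup (integralClosure (v.adicCompletionIntegers K) (w.adicCompletion L))
          (Q₂.conjTranspose * H * Q₂)) ≃ₐ[k]
        heckeAlgebra k (hyperspecialSubgroup (integralClosure (v.adicCompletionIntegers K) (w.adicCompletion L))
          (Q₁.conjTranspose * H * Q₁))) := by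
  letI := starRingOfQuadratic h2 σ hσ
  -- `𝒪_{E_v}` has fraction field `L_w` (Mathlib, `[L_w : K_v]` finite)
  haveI : IsFractionRing (integralClosure (v.adicCompletionIntegers K) (w.adicCompletion L))
      (w.adicCompletion L) :=
    integralClosure.isFractionRing_of_finite_extension (v.adicCompletion K) (w.adicCompletion L)
  have hQ₁det : IsUnit Q₁.det := (Matrix.isUnit_iff_isUnit_det Q₁).1 hQ₁
  have hQ₂det : IsUnit Q₂.det := (Matrix.isUnit_iff_isUnit_det Q₂).1 hQ₂
  set G₁ : Matrix (Fin 3) (Fin 3) (w.adicCompletion L) := Q₁.conjTranspose * H * Q₁ with hG₁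
  set G₂ : Matrix (Fin 3) (Fin 3) (w.adicCompletion L) := Q₂.conjTranspose * H * Q₂ with hG₂
  have hG₁h : G₁.IsHermitian := Matrix.isHermitian_conjTranspose_mul_mul Q₁ hH
  have hG₂h : G₂.IsHermitian := Matrix.isHermitian_conjTranspose_mul_mul Q₂ hH
  have hdet₁ : IsUnit G₁.det := by
    rw [hG₁, Matrix.det_mul, Matrix.det_mul, Matrix.det_conjTranspose]
    exact ((isUnit_star.mpr hQ₁det).mul hdet).mul hQ₁det
  have hdet₂ : IsUnit G₂.det := by
    rw [hG₂, Matrix.det_mul, Matrix.det_mul, Matrix.det_conjTranspose]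
    exact ((isUnit_star.mpr hQ₂det).mul hdet).mul hQ₂det
  obtain ⟨P₁, hP₁, hP₁det, hPHP₁⟩ :=
    exists_congruent_J3_one_of_dualLattice_eq v w h2 hϖ hinert σ hσ hG₁h hdet₁ h₁
  obtain ⟨P₂, hP₂, hP₂det, hPHP₂⟩ :=
    exists_congruent_J3_one_of_dualLattice_eq v w h2 hϖ hinert σ hσ hG₂h hdet₂ h₂
  obtain ⟨M, hM, hMdet, hG⟩ := exists_congruent_integral_of_J3_one hP₁ hP₁det hPHP₁ hP₂ hP₂det hPHP₂
  exact nonempty_heckeAlgebra_algEquiv_of_congruent_integral k hM hMdet hG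

end Local

end Summit.Ventures.HodgeRepro2.T5InertSelfDualHecke
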